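import Literature.AlgebraicGeometry.Frobenioids.PadicFrobenioidPairIsoImage
import HarnessLib

/-!
# Frobenioids II, Thm. 2.4 (ii): the direct limit `lim→_k K_{Π/N_k}^×` IS `ℚ̄_p^×`, equivariantly — the reconstructed
# multiplicative group on the nose

Mochizuki, *The geometry of Frobenioids II*, Kyushu J. Math. **62** (2008) 401–460, §2, proof of Theorem 2.4 (ii), author's
text p. 20 l.−5 – p. 21 l. 6 [cite: MochizukiFrdII2008, Thm 2.4 (ii) p.21]: "it follows — by varying the objects `Aᵢ` and
reconstructing the multiplicative group associated to the field determined by the image of `Aᵢ` … — that `Ψ` induces a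
pair of compatible isomorphisms `G₁ ⥲ G₂`; `K̄₁^× ⥲ K̄₂^×` [well-defined up to composition with an element of `G₂`]";
setting of Definition 2.2, p. 17 [cite: MochizukiFrdII2008, Def 2.2 p.17]: "`K̄`" is an algebraic closure of `ℚ_p`,
`G := Im(Π) ⊆ Q = G_{ℚ_p}`.

PROOF-ONLY companion (cell abc-iut, `plan/L1/SUBDAG-FrdII-Thm24.md` row W12-L17 `PairIso`, node FrdII:Thm2.4(ii); seat
abc-iut-w5-d229).  The W12-L17 files (`PadicFrobenioidPairIso*`, abc-iut-w5-d194 / w5-d229) produce the printed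
"`K̄ᵢ^×`" as the ABSTRACT direct limit `lim→_k K_{Π/N_k}^×` of the field units along the universal pro-covering tower of
the base, with its deck action.  Over the GENUINE base functor of §2, `CosetCat.push φ ⋙ CosetCat.toConnected ⋙
QuasiTemperoid.galoisPadicFields p` (`Π/U ↦ Spec ℚ̄_p^{Stab}` through an open homomorphism `φ : Π → G_{ℚ_p}`), every
`K_{Π/N_k}` is a subfield `ℚ̄_p^{x_k φ(N_k) x_k⁻¹}` of THE algebraic closure `ℚ̄_p = AlgebraicClosure ℚ_[p]` (`x_k` a
representative of the base point), and this file identifies the direct limit with the literal `ℚ̄_p^×`: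
* `genuine_map_cproj_apply` — TRANSITION FORMULA: the projection `Π/N → Π/M` goes to `a ↦ (x_N x_M⁻¹)·a`;
* `inv_apply_map_eq` — hence the STRAIGHTENED embeddings `K_{Π/N_k} → ℚ̄_p`, `a ↦ x_k⁻¹·a`, form a cocone;
* `exists_colimitIso_fbarUnits` — **`ι : lim→_k K_{Π/N_k}^× ⥲ ℚ̄_p^×`**, an isomorphism of commutative monoids (injective:
  field maps; surjective: every `b ∈ ℚ̄_p` lies, with its `G_{ℚ_p}`-orbit, in `K_{Π/N_k}` for `k ≫ 0` —
  `exists_orbit_mem_fixFld_genuine`) with leg `k` equal to `a ↦ x_k⁻¹·a`, INTERTWINING the deck transformation `r_g`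
  with the Galois action of `φ(g)` on `ℚ̄_p^×` (action formula `genuine_map_crightMul_apply`): the reconstructed
  multiplicative group with its `Π`-action IS `ℚ̄_p^×` with `Π` acting through `Π → G ⊆ G_{ℚ_p}`;
* `exists_rep_basePt_seq` — representatives exist, so the identification is available for every tower.
Sequel `PadicFrobenioidPairIsoAlgClosure.lean`: the printed pair `G₁ ⥲ G₂`, `ℚ̄_{p₁}^× ⥲ ℚ̄_{p₂}^×` on the algebraic
closures.  Theorems only (no definitions); elementary Galois theory and filtered colimits over the tree's landed files;
nothing here bears on [IUTchIII] Cor. 3.12.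
-/

noncomputable section

namespace Literature.AlgebraicGeometry.Frobenioids

open CategoryTheory CategoryTheory.Limits Opposite Topology Filter
open Literature.AnabelianGeometry.SemiGraphs QuasiTemperoid

namespace BaseGaloisSystem

/-! ### §1 Levelwise: the fields `K_{Π/N_k} ⊆ ℚ̄_p`, their transition maps, and the straightened embeddings -/

section Levels

variable {p : ℕ} [Fact p.Prime] {G : Type} [Group G] [TopologicalSpace G]
  (φ : G →* GalFbar ℚ_[p]) (hφ : IsOpenHom φ)

/-- **Transition formula.**  Over the genuine base, the projection `Π/N → Π/M` (`N ≤ M`) goes to the field map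
`K_{Π/M} → K_{Π/N}`, `a ↦ (x_N x_M⁻¹)·a`, where `x_N`, `x_M ∈ G_{ℚ_p}` represent the base points (the point of the
projection is the trivial coset, so the carrying element is `x_N · 1 · x_M⁻¹`). [cite: MochizukiFrdII2008, Thm 2.4 (ii) p.21] -/
theorem genuine_map_cproj_apply {N' M : OpenNormalSubgroup G} (h : N' ≤ M) {xN xM : GalFbar ℚ_[p]}
    (hxN : (xN : ((CosetCat.push φ hφ.isOpenMap).obj (cQ N')).carrier) =
      (basePt ((CosetCat.toConnected (isTempered_galFbar ℚ_[p])).obj ((CosetCat.push φ hφ.isOpenMap).obj (cQ N'))) :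
        ((CosetCat.push φ hφ.isOpenMap).obj (cQ N')).carrier))
    (hxM : (xM : ((CosetCat.push φ hφ.isOpenMap).obj (cQ M)).carrier) =
      (basePt ((CosetCat.toConnected (isTempered_galFbar ℚ_[p])).obj ((CosetCat.push φ hφ.isOpenMap).obj (cQ M))) :
        ((CosetCat.push φ hφ.isOpenMap).obj (cQ M)).carrier))
    (a : fixFld ℚ_[p] ((CosetCat.toConnected (isTempered_galFbar ℚ_[p])).obj ((CosetCat.push φ hφ.isOpenMap).obj (cQ M)))) :
    (fieldMap ((CosetCat.toConnected (isTempered_galFbar ℚ_[p])).map ((CosetCat.push φ hφ.isOpenMap).map (cproj h))) a :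
      Fbar ℚ_[p]) = (xN * xM⁻¹) (a : Fbar ℚ_[p]) := by
  have hc : ((1 : GalFbar ℚ_[p]) : ((CosetCat.push φ hφ.isOpenMap).obj (cQ M)).carrier) =
      CosetCat.pt ((CosetCat.push φ hφ.isOpenMap).map (cproj h)) := by
    rw [CosetCat.pt_push_map, pt_cproj, CosetCat.pushQuot_coe, map_one]
  rw [galoisPadicFields_toConnected_map_apply p ((CosetCat.push φ hφ.isOpenMap).map (cproj h)) hxN hxM hc a, mul_one]

variable (N : ℕ → OpenNormalSubgroup G) (hN : Antitone N)

/-- The transition map of `lim→_k K_{Π/N_k}^×` on values: level `j → k` is the field map of the projection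
`Π/N_k → Π/N_j` (definitional unfolding of `B₀|_D` along the coset system). [cite: MochizukiFrdII2008, Thm 2.4 (ii) p.21] -/
theorem cosetSystem_bZeroOn_genuine_map_coe {j k : ℕ} (f : j ⟶ k)
    (u : (cosetSystem N hN ⋙ PadicFrd.bZeroOn
      (CosetCat.push φ hφ.isOpenMap ⋙ CosetCat.toConnected (isTempered_galFbar ℚ_[p]) ⋙ galoisPadicFields p)).obj j) :
    (((show (fixFld ℚ_[p] ((CosetCat.toConnected (isTempered_galFbar ℚ_[p])).obj
          ((CosetCat.push φ hφ.isOpenMap).obj (cQ (N k)))))ˣ from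
        (cosetSystem N hN ⋙ PadicFrd.bZeroOn
          (CosetCat.push φ hφ.isOpenMap ⋙ CosetCat.toConnected (isTempered_galFbar ℚ_[p]) ⋙ galoisPadicFields p)).map f u) :
        fixFld ℚ_[p] ((CosetCat.toConnected (isTempered_galFbar ℚ_[p])).obj ((CosetCat.push φ hφ.isOpenMap).obj (cQ (N k))))) :
          Fbar ℚ_[p]) =
      (fieldMap ((CosetCat.toConnected (isTempered_galFbar ℚ_[p])).map ((CosetCat.push φ hφ.isOpenMap).map (cproj (hN f.le))))
        ((show (fixFld ℚ_[p] ((CosetCat.toConnected (isTempered_galFbar ℚ_[p])).obj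
          ((CosetCat.push φ hφ.isOpenMap).obj (cQ (N j)))))ˣ from u) :
          fixFld ℚ_[p] ((CosetCat.toConnected (isTempered_galFbar ℚ_[p])).obj ((CosetCat.push φ hφ.isOpenMap).obj (cQ (N j))))) : Fbar ℚ_[p]) := rfl

/-- **The straightened embeddings form a cocone.**  With `x_k ∈ G_{ℚ_p}` representing the base point of level `k`, the
maps `K_{Π/N_k} → ℚ̄_p`, `a ↦ x_k⁻¹·a` are compatible with the transition maps `a ↦ (x_k x_j⁻¹)·a`.
[cite: MochizukiFrdII2008, Thm 2.4 (ii) p.21] -/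
theorem inv_apply_map_eq {j k : ℕ} (f : j ⟶ k) (x : ℕ → GalFbar ℚ_[p])
    (hx : ∀ k, (x k : ((CosetCat.push φ hφ.isOpenMap).obj (cQ (N k))).carrier) =
      (basePt ((CosetCat.toConnected (isTempered_galFbar ℚ_[p])).obj ((CosetCat.push φ hφ.isOpenMap).obj (cQ (N k)))) :
        ((CosetCat.push φ hφ.isOpenMap).obj (cQ (N k))).carrier))
    (u : (cosetSystem N hN ⋙ PadicFrd.bZeroOn
      (CosetCat.push φ hφ.isOpenMap ⋙ CosetCat.toConnected (isTempered_galFbar ℚ_[p]) ⋙ galoisPadicFields p)).obj j) :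
    (x k)⁻¹ (((show (fixFld ℚ_[p] ((CosetCat.toConnected (isTempered_galFbar ℚ_[p])).obj
          ((CosetCat.push φ hφ.isOpenMap).obj (cQ (N k)))))ˣ from
        (cosetSystem N hN ⋙ PadicFrd.bZeroOn
          (CosetCat.push φ hφ.isOpenMap ⋙ CosetCat.toConnected (isTempered_galFbar ℚ_[p]) ⋙ galoisPadicFields p)).map f u) :
        fixFld ℚ_[p] ((CosetCat.toConnected (isTempered_galFbar ℚ_[p])).obj ((CosetCat.push φ hφ.isOpenMap).obj (cQ (N k))))) :
          Fbar ℚ_[p]) =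
      (x j)⁻¹ (((show (fixFld ℚ_[p] ((CosetCat.toConnected (isTempered_galFbar ℚ_[p])).obj
          ((CosetCat.push φ hφ.isOpenMap).obj (cQ (N j)))))ˣ from u) :
          fixFld ℚ_[p] ((CosetCat.toConnected (isTempered_galFbar ℚ_[p])).obj ((CosetCat.push φ hφ.isOpenMap).obj (cQ (N j))))) : Fbar ℚ_[p]) := by
  rw [cosetSystem_bZeroOn_genuine_map_coe φ hφ N hN f u, genuine_map_cproj_apply φ hφ (hN f.le) (hx k) (hx j)]
  rw [AlgEquiv.mul_apply, ← AlgEquiv.mul_apply (x k)⁻¹ (x k), inv_mul_cancel, AlgEquiv.one_apply]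


/-! ### §2 The identification `lim→_k K_{Π/N_k}^× ≅ ℚ̄_p^×`, `Π`-equivariant through `φ` -/

/-- The deck transformation `r_g` on `lim→_k K_{Π/N_k}^×`, level `k`, on values: the field map of `r_g : Π/N_k → Π/N_k`
(definitional unfolding). [cite: MochizukiFrdII2008, Thm 2.4 (ii) p.21] -/
theorem whiskerRight_toAutCoset_bZeroOn_genuine_app_coe (g : G) (k : ℕ)
    (u : (cosetSystem N hN ⋙ PadicFrd.bZeroOn
      (CosetCat.push φ hφ.isOpenMap ⋙ CosetCat.toConnected (isTempered_galFbar ℚ_[p]) ⋙ galoisPadicFields p)).obj k) :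
    (((show (fixFld ℚ_[p] ((CosetCat.toConnected (isTempered_galFbar ℚ_[p])).obj
          ((CosetCat.push φ hφ.isOpenMap).obj (cQ (N k)))))ˣ from
        (Functor.whiskerRight (toAutCoset N hN g).hom (PadicFrd.bZeroOn
          (CosetCat.push φ hφ.isOpenMap ⋙ CosetCat.toConnected (isTempered_galFbar ℚ_[p]) ⋙ galoisPadicFields p))).app k u) :
        fixFld ℚ_[p] ((CosetCat.toConnected (isTempered_galFbar ℚ_[p])).obj ((CosetCat.push φ hφ.isOpenMap).obj (cQ (N k))))) :
          Fbar ℚ_[p]) =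
      (fieldMap ((CosetCat.toConnected (isTempered_galFbar ℚ_[p])).map ((CosetCat.push φ hφ.isOpenMap).map (crightMul (N k) g)))
        ((show (fixFld ℚ_[p] ((CosetCat.toConnected (isTempered_galFbar ℚ_[p])).obj
          ((CosetCat.push φ hφ.isOpenMap).obj (cQ (N k)))))ˣ from u) :
          fixFld ℚ_[p] ((CosetCat.toConnected (isTempered_galFbar ℚ_[p])).obj ((CosetCat.push φ hφ.isOpenMap).obj (cQ (N k))))) :
          Fbar ℚ_[p]) := rfl

/-- **`lim→_k K_{Π/N_k}^× = ℚ̄_p^×`, equivariantly.**  Over the genuine base `Π/U ↦ Spec ℚ̄_p^{Stab}` (through an open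
homomorphism `φ : Π → G_{ℚ_p}`) and for a cofinal antitone `N`, with `x_k ∈ G_{ℚ_p}` representing the base point of
level `k`: the straightened embeddings `K_{Π/N_k}^× → ℚ̄_p^×`, `a ↦ x_k⁻¹·a` induce an ISOMORPHISM of commutative monoids
`ι : lim→_k K_{Π/N_k}^× ⥲ ℚ̄_p^×` (injective: field maps; surjective: every `b ∈ ℚ̄_p` with its `G_{ℚ_p}`-orbit lies in
`K_{Π/N_k}` for `k ≫ 0`, `exists_orbit_mem_fixFld_genuine`) which intertwines the deck transformation `r_g` with the
Galois action of `φ(g)` on `ℚ̄_p^×` (`genuine_map_crightMul_apply`) — "reconstructing the multiplicative group associated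
to the field … `K̄ᵢ^×`" as the ACTUAL `ℚ̄_p^×` with its `Π`-action through `Π → G ⊆ G_{ℚ_p}`.
[cite: MochizukiFrdII2008, Thm 2.4 (ii) p.21] -/
theorem exists_colimitIso_fbarUnits (hNb : ∀ U ∈ 𝓝 (1 : G), ∃ k, (N k : Set G) ⊆ U) (x : ℕ → GalFbar ℚ_[p])
    (hx : ∀ k, (x k : ((CosetCat.push φ hφ.isOpenMap).obj (cQ (N k))).carrier) =
      (basePt ((CosetCat.toConnected (isTempered_galFbar ℚ_[p])).obj ((CosetCat.push φ hφ.isOpenMap).obj (cQ (N k)))) :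
        ((CosetCat.push φ hφ.isOpenMap).obj (cQ (N k))).carrier))
    [HasColimit (cosetSystem N hN ⋙ PadicFrd.bZeroOn
      (CosetCat.push φ hφ.isOpenMap ⋙ CosetCat.toConnected (isTempered_galFbar ℚ_[p]) ⋙ galoisPadicFields p))] :
    ∃ ι : colimit (cosetSystem N hN ⋙ PadicFrd.bZeroOn
        (CosetCat.push φ hφ.isOpenMap ⋙ CosetCat.toConnected (isTempered_galFbar ℚ_[p]) ⋙ galoisPadicFields p)) ≅
        CommMonCat.of (Fbar ℚ_[p])ˣ,
      (∀ (k : ℕ) (u : (cosetSystem N hN ⋙ PadicFrd.bZeroOn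
          (CosetCat.push φ hφ.isOpenMap ⋙ CosetCat.toConnected (isTempered_galFbar ℚ_[p]) ⋙ galoisPadicFields p)).obj k),
        ((ι.hom (colimit.ι (cosetSystem N hN ⋙ PadicFrd.bZeroOn
          (CosetCat.push φ hφ.isOpenMap ⋙ CosetCat.toConnected (isTempered_galFbar ℚ_[p]) ⋙ galoisPadicFields p)) k u) :
            (Fbar ℚ_[p])ˣ) : Fbar ℚ_[p]) =
          (x k)⁻¹ (((show (fixFld ℚ_[p] ((CosetCat.toConnected (isTempered_galFbar ℚ_[p])).obj
            ((CosetCat.push φ hφ.isOpenMap).obj (cQ (N k)))))ˣ from u) :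
            fixFld ℚ_[p] ((CosetCat.toConnected (isTempered_galFbar ℚ_[p])).obj ((CosetCat.push φ hφ.isOpenMap).obj (cQ (N k))))) :
              Fbar ℚ_[p])) ∧
      ∀ g : G, colimMap (Functor.whiskerRight (toAutCoset N hN g).hom (PadicFrd.bZeroOn
          (CosetCat.push φ hφ.isOpenMap ⋙ CosetCat.toConnected (isTempered_galFbar ℚ_[p]) ⋙ galoisPadicFields p))) ≫ ι.hom =
        ι.hom ≫ CommMonCat.ofHom (Units.map ((φ g : GalFbar ℚ_[p]) : Fbar ℚ_[p] →* Fbar ℚ_[p])) := by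
  -- notation-free abbreviations
  let base := CosetCat.push φ hφ.isOpenMap ⋙ CosetCat.toConnected (isTempered_galFbar ℚ_[p]) ⋙ galoisPadicFields p
  let F := cosetSystem N hN ⋙ PadicFrd.bZeroOn base
  let K : ℕ → IntermediateField ℚ_[p] (Fbar ℚ_[p]) := fun k =>
    fixFld ℚ_[p] ((CosetCat.toConnected (isTempered_galFbar ℚ_[p])).obj ((CosetCat.push φ hφ.isOpenMap).obj (cQ (N k))))
  -- the straightened embedding of level `k`: `a ↦ x_k⁻¹ · a` on units
  let emb : ∀ k, (K k)ˣ →* (Fbar ℚ_[p])ˣ := fun k =>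
    Units.map ((((x k)⁻¹ : GalFbar ℚ_[p]) : Fbar ℚ_[p] →* Fbar ℚ_[p]).comp ((K k).val : K k →* Fbar ℚ_[p]))
  have emb_coe : ∀ (k : ℕ) (u : (K k)ˣ), ((emb k u : (Fbar ℚ_[p])ˣ) : Fbar ℚ_[p]) = (x k)⁻¹ ((u : K k) : Fbar ℚ_[p]) :=
    fun k u => rfl
  let leg : ∀ k, F.obj k ⟶ CommMonCat.of (Fbar ℚ_[p])ˣ := fun k =>
    show CommMonCat.of (K k)ˣ ⟶ CommMonCat.of (Fbar ℚ_[p])ˣ from CommMonCat.ofHom (emb k)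
  have leg_coe : ∀ (k : ℕ) (u : F.obj k), ((leg k u : (Fbar ℚ_[p])ˣ) : Fbar ℚ_[p]) =
      (x k)⁻¹ (((show (K k)ˣ from u) : K k) : Fbar ℚ_[p]) := fun k u => rfl
  -- the cocone
  let c : Cocone F :=
    { pt := CommMonCat.of (Fbar ℚ_[p])ˣ
      ι := { app := leg
             naturality := fun j k f => by
               apply CommMonCat.ext
               intro u
               change leg k (F.map f u) = leg j u
               apply Units.ext
               rw [leg_coe, leg_coe]
               exact inv_apply_map_eq φ hφ N hN f x hx u } }
  let ident : colimit F ⟶ CommMonCat.of (Fbar ℚ_[p])ˣ := colimit.desc F c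
  have ident_ι : ∀ (k : ℕ) (u : F.obj k), ident (colimit.ι F k u) = leg k u := fun k u => by
    rw [← CommMonCat.comp_apply, colimit.ι_desc]
  -- surjective
  have hsurj : Function.Surjective ident := by
    intro v
    obtain ⟨k, hk⟩ := exists_orbit_mem_fixFld_genuine φ hφ N hNb (v : Fbar ℚ_[p])
    have hvk : x k (v : Fbar ℚ_[p]) ≠ 0 := (map_ne_zero_iff _ (x k).injective).mpr v.ne_zero
    let a : K k := ⟨x k (v : Fbar ℚ_[p]), hk (x k)⟩
    have ha : (a : Fbar ℚ_[p]) ≠ 0 := hvk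
    let u : (K k)ˣ := Units.mk0 a (fun h => ha (by rw [h]; rfl))
    refine ⟨colimit.ι F k u, ?_⟩
    rw [ident_ι]
    apply Units.ext
    rw [leg_coe]
    change (x k)⁻¹ (x k (v : Fbar ℚ_[p])) = (v : Fbar ℚ_[p])
    rw [← AlgEquiv.mul_apply, inv_mul_cancel, AlgEquiv.one_apply]
  -- injective
  have hinj : Function.Injective ident := by
    intro z₁ z₂ h
    obtain ⟨j, u₁, rfl⟩ := Concrete.colimit_exists_rep F z₁
    obtain ⟨k, u₂, rfl⟩ := Concrete.colimit_exists_rep F z₂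
    rw [ident_ι, ident_ι] at h
    have h' := congrArg (fun w : (Fbar ℚ_[p])ˣ => (w : Fbar ℚ_[p])) h
    simp only [leg_coe] at h'
    -- move both to level `m = max j k`
    let m := max j k
    let f₁ : j ⟶ m := homOfLE (le_max_left j k)
    let f₂ : k ⟶ m := homOfLE (le_max_right j k)
    apply Concrete.colimit_rep_eq_of_exists
    refine ⟨m, f₁, f₂, ?_⟩
    have h₁ := inv_apply_map_eq φ hφ N hN f₁ x hx u₁
    have h₂ := inv_apply_map_eq φ hφ N hN f₂ x hx u₂
    rw [h', ← h₂] at h₁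
    have h₃ := (x m)⁻¹.injective h₁
    exact Units.ext (Subtype.ext h₃)
  haveI : IsIso ident := (ConcreteCategory.isIso_iff_bijective ident).mpr ⟨hinj, hsurj⟩
  refine ⟨asIso ident, fun k u => ?_, fun g => ?_⟩
  · rw [asIso_hom, ident_ι, leg_coe]
  · rw [asIso_hom]
    refine colimit.hom_ext fun k => ?_
    rw [ι_colimMap_assoc, colimit.ι_desc, colimit.ι_desc_assoc]
    apply CommMonCat.ext
    intro u
    apply Units.ext
    change ((leg k ((Functor.whiskerRight (toAutCoset N hN g).hom (PadicFrd.bZeroOn base)).app k u) : (Fbar ℚ_[p])ˣ) :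
        Fbar ℚ_[p]) = ((Units.map ((φ g : GalFbar ℚ_[p]) : Fbar ℚ_[p] →* Fbar ℚ_[p]) (leg k u) : (Fbar ℚ_[p])ˣ) : Fbar ℚ_[p])
    rw [leg_coe, whiskerRight_toAutCoset_bZeroOn_genuine_app_coe φ hφ N hN g k u,
      genuine_map_crightMul_apply φ hφ (N k) g (hx k),
      Units.coe_map, leg_coe]
    change ((x k)⁻¹ * (x k * φ g * (x k)⁻¹)) _ = (φ g * (x k)⁻¹) _
    rw [← mul_assoc, ← mul_assoc, inv_mul_cancel, one_mul]

/-- Representatives of the base points of the tower exist (every level), so `exists_colimitIso_fbarUnits` applies with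
SOME straightening. [cite: MochizukiFrdII2008, Thm 2.4 (ii) p.21] -/
theorem exists_rep_basePt_seq :
    ∃ x : ℕ → GalFbar ℚ_[p], ∀ k, (x k : ((CosetCat.push φ hφ.isOpenMap).obj (cQ (N k))).carrier) =
      (basePt ((CosetCat.toConnected (isTempered_galFbar ℚ_[p])).obj ((CosetCat.push φ hφ.isOpenMap).obj (cQ (N k)))) :
        ((CosetCat.push φ hφ.isOpenMap).obj (cQ (N k))).carrier) := by
  choose x hx using fun k => exists_rep_basePt p ((CosetCat.push φ hφ.isOpenMap).obj (cQ (N k)))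
  exact ⟨x, hx⟩

end Levels

end BaseGaloisSystem

end Literature.AlgebraicGeometry.Frobenioids

end
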